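import Literature.Analysis.FunctionSpaces.TorusAxisAverage
import Summits.AnomalousDissipation.AnomalousDissipation.Theorems.SawtoothPulseCascadeK1LocalisedCascadeAxisMoment

/-!
# K1loc, line `Spectral` / SeqCone — helper: WIENER MOMENTS OF A `1/N`-PERIODIC AXIS CUT-OFF (S-B tool, the dilation gain)

Helper file of the prover lane on the crux `K1LocalisedCascade` (stmt-AnomalousDissipation-19491), route
`SawtoothPulseCascade` (memo v7 §3 rev 2).  The cut-offs of phase `j` are `1/N_j`-periodic in the sheared coordinate (they are
read off the profile `U_j`, of period `1/N_j`), so their spectra live on `N_j ℤ·e_j`; feeding this into the Carlson bound of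
`…AxisMoment` gains the factor `√N_j` that the plain bound loses (the identity `‖(F(N·))′‖_A = N‖F′‖_A` in disguise):

* `mFourierCoeff_eq_zero_of_axis_periodic` — if `f(x + N⁻¹·eᵢ) = f(x)` for all `x` then `𝓕f(k) = 0` unless `N ∣ kᵢ`;
* `tsum_moment_le_of_axis_periodic` — as `…AxisMoment.tsum_moment_le_of_axis` but for a spectrum supported on `{n = q eⱼ : N ∣ q}`:
  `Σ_n ω(n)‖𝓕X(n)‖ ≤ (L/2π)·(√(2Q)·√(∫‖X₁‖²) + √(∫‖X₂‖²)/(N·π√(2Q)))` — the second-derivative term is divided by `N`, so the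
  optimal choice of `Q` gives `≈ (L/π^{3/2})√(‖X₁‖₂‖X₂‖₂/N)`, which for `4N` ramps of width `ℓ` is `O(L/ℓ)` uniformly in `N`
  (the true order of the Wiener norm of `X′`).

WHAT THIS IS NOT: no statement about the cascade or the stub. [cite: Grafakos2014, Prop. 3.1.2 (coefficients of derivatives and
translates) and Prop. 3.2.7 (3) (Parseval)] [problem: turb]
-/

-- `Summit.<Summit>.<Problem>`: single-conjunct summit, the duplicate namespace segment is deliberate.
set_option linter.dupNamespace false

noncomputable section

namespace Summit.AnomalousDissipation.AnomalousDissipation.Theorems.SawtoothPulseCascade.K1Slot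

open MeasureTheory Filter Topology Complex UnitAddTorus
open Literature.Analysis Literature.Analysis.FunctionSpaces Literature.Analysis.FunctionSpaces.Torus

variable {d : Type*} [Fintype d] [DecidableEq d]

/-! ## §1 Periodicity along an axis kills the off-lattice modes -/

/-- `e_k(1/N) = 1` forces `N ∣ k` (for `N ≥ 1`). [folklore] -/
theorem int_dvd_of_fourier_inv_eq_one {N : ℕ} (hN : 1 ≤ N) {k : ℤ}
    (h : (fourier k (((1 : ℝ) / N : ℝ) : UnitAddCircle) : ℂ) = 1) : (N : ℤ) ∣ k := by
  have hN0 : (N : ℝ) ≠ 0 := by exact_mod_cast (by omega : N ≠ 0)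
  rw [fourier_coe_apply] at h
  obtain ⟨n, hn⟩ := Complex.exp_eq_one_iff.mp h
  -- `2π i k (1/N) = n · 2π i` ⇒ `k = n N`
  have h1 : (k : ℂ) * (1 / (N : ℂ)) = (n : ℂ) := by
    have h2πi : (2 * Real.pi * Complex.I : ℂ) ≠ 0 := by
      simp [Real.pi_ne_zero, Complex.I_ne_zero]
    have : (2 * Real.pi * Complex.I) * ((k : ℂ) * (1 / (N : ℂ))) = (2 * Real.pi * Complex.I) * (n : ℂ) := by
      rw [← mul_comm (n : ℂ)]; convert hn using 1; push_cast; ring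
    exact mul_left_cancel₀ h2πi this
  have h2 : (k : ℂ) = (n : ℂ) * (N : ℂ) := by
    have hNc : (N : ℂ) ≠ 0 := by exact_mod_cast (by omega : N ≠ 0)
    field_simp at h1
    linear_combination h1
  have h3 : k = n * (N : ℤ) := by exact_mod_cast h2
  exact ⟨n, by rw [h3]; ring⟩

/-- **A function `1/N`-periodic along the axis `i` has no modes `k` with `N ∤ kᵢ`.** [cite: Grafakos2014, Prop. 3.1.2 (coefficients of translates)] -/
theorem mFourierCoeff_eq_zero_of_axis_periodic {F : Type*} [NormedAddCommGroup F] [NormedSpace ℂ F] [CompleteSpace F]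
    {f : UnitAddTorus d → F} {i : d} {N : ℕ} (hN : 1 ≤ N)
    (hf : ∀ x : UnitAddTorus d, f (x + Pi.single i (((1 : ℝ) / N : ℝ) : UnitAddCircle)) = f x) {k : d → ℤ}
    (hk : ¬ (N : ℤ) ∣ k i) : mFourierCoeff f k = 0 := by
  have h := mFourierCoeff_comp_add_single f k i (((1 : ℝ) / N : ℝ) : UnitAddCircle)
  have hfe : (fun x => f (x + Pi.single i (((1 : ℝ) / N : ℝ) : UnitAddCircle))) = f := funext hf
  rw [hfe] at h
  -- `(1 − e_{k_i}(1/N)) • 𝓕f(k) = 0` with a non-zero scalar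
  have hne : (fourier (k i) (((1 : ℝ) / N : ℝ) : UnitAddCircle) : ℂ) ≠ 1 := fun h1 => hk (int_dvd_of_fourier_inv_eq_one hN h1)
  have h' : ((1 : ℂ) - fourier (k i) (((1 : ℝ) / N : ℝ) : UnitAddCircle)) • mFourierCoeff f k = 0 := by
    rw [sub_smul, one_smul, ← h, sub_self]
  rcases smul_eq_zero.mp h' with h0 | h0
  · exact absurd (sub_eq_zero.mp h0).symm hne
  · exact h0

/-! ## §2 The moment bound with the dilation gain -/

/-- **Wiener moments of a `1/N`-periodic axis cut-off.**  As `tsum_moment_le_of_axis`, with the spectrum of `X` supported on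
`{q·eⱼ : N ∣ q}` (`N ≥ 1`): `Σ_n ω(n)‖𝓕X(n)‖ ≤ (L/(2π))·(√(2Q)·√(∫‖X₁‖²) + √(∫‖X₂‖²)/(N·(π·√(2Q))))`.
[cite: Grafakos2014, Prop. 3.1.2 and Prop. 3.2.7 (3)] -/
theorem tsum_moment_le_of_axis_periodic {X X₁ X₂ : UnitAddTorus d → ℂ} (hX₁ : Continuous X₁) (hX₂ : Continuous X₂) (j : d)
    {N : ℕ} (hN : 1 ≤ N)
    (hsupp : ∀ n : d → ℤ, mFourierCoeff X n ≠ 0 → (∀ l, l ≠ j → n l = 0) ∧ (N : ℤ) ∣ n j)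
    (h1 : ∀ n : d → ℤ, mFourierCoeff X₁ n = (2 * Real.pi * Complex.I * (n j)) * mFourierCoeff X n)
    (h2 : ∀ n : d → ℤ, mFourierCoeff X₂ n = (2 * Real.pi * Complex.I * (n j)) * mFourierCoeff X₁ n)
    {ω : (d → ℤ) → ℝ} {L : ℝ} (hL : 0 ≤ L) (hω0 : ∀ n, 0 ≤ ω n) (hω : ∀ n, ω n ≤ L * |((n j : ℤ) : ℝ)|)
    {Q : ℕ} (hQ : 1 ≤ Q) :
    (Summable fun n => ω n * ‖mFourierCoeff X n‖) ∧
      ∑' n, ω n * ‖mFourierCoeff X n‖ ≤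
        L / (2 * Real.pi) * (Real.sqrt (2 * Q) * Real.sqrt (∫ x, ‖X₁ x‖ ^ 2) +
          Real.sqrt (∫ x, ‖X₂ x‖ ^ 2) / ((N : ℝ) * (Real.pi * Real.sqrt (2 * Q)))) := by
  have hπ : 0 < Real.pi := Real.pi_pos
  have hNpos : (0 : ℝ) < N := by exact_mod_cast hN
  have hNz : (N : ℤ) ≠ 0 := by exact_mod_cast (by omega : N ≠ 0)
  -- the lattice `q ↦ (N q) eⱼ`
  set g : ℤ → (d → ℤ) := fun q => Pi.single j ((N : ℤ) * q) with hg_def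
  have hinj : Function.Injective g := by
    intro a b h
    have := congr_fun h j
    simp only [hg_def, Pi.single_eq_same] at this
    exact mul_left_cancel₀ hNz this
  -- the axis sequences (with the dilation gain in `D`)
  set c : ℤ → ℂ := fun q => mFourierCoeff X₁ (g q) with hc_def
  set D : ℤ → ℂ := fun q => (1 / (N : ℂ)) * mFourierCoeff X₂ (g q) with hD_def
  have hgj : ∀ q, g q j = (N : ℤ) * q := fun q => by simp [hg_def]
  have hDq : ∀ q : ℤ, D q = (2 * Real.pi * Complex.I * q) * c q := fun q => by
    have hNc : (N : ℂ) ≠ 0 := by exact_mod_cast (by omega : N ≠ 0)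
    simp only [hD_def, hc_def, h2, hgj]; push_cast; field_simp
  -- Parseval on the lattice
  have hP1 := hasSum_sq_mFourierCoeff_of_continuous hX₁
  have hP2 := hasSum_sq_mFourierCoeff_of_continuous hX₂
  have hc2 : Summable (fun q => ‖c q‖ ^ 2) ∧ ∑' q, ‖c q‖ ^ 2 ≤ ∫ x, ‖X₁ x‖ ^ 2 := by
    have hs : Summable ((fun n => ‖mFourierCoeff X₁ n‖ ^ 2) ∘ g) := hP1.summable.comp_injective hinj
    refine ⟨hs, ?_⟩
    rw [← hP1.tsum_eq]
    exact tsum_comp_le_tsum_of_inj hP1.summable (fun n => sq_nonneg _) hinj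
  have hD2 : Summable (fun q => ‖D q‖ ^ 2) ∧ ∑' q, ‖D q‖ ^ 2 ≤ (∫ x, ‖X₂ x‖ ^ 2) / (N : ℝ) ^ 2 := by
    have hs : Summable ((fun n => ‖mFourierCoeff X₂ n‖ ^ 2) ∘ g) := hP2.summable.comp_injective hinj
    have hDn : ∀ q, ‖D q‖ ^ 2 = (1 / (N : ℝ) ^ 2) * ‖mFourierCoeff X₂ (g q)‖ ^ 2 := fun q => by
      rw [hD_def]; simp only []
      rw [norm_mul, mul_pow, norm_div, norm_one, Complex.norm_natCast]; ring
    refine ⟨(hs.mul_left _).congr fun q => (hDn q).symm, ?_⟩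
    calc ∑' q, ‖D q‖ ^ 2 = ∑' q, (1 / (N : ℝ) ^ 2) * ‖mFourierCoeff X₂ (g q)‖ ^ 2 := tsum_congr hDn
      _ = (1 / (N : ℝ) ^ 2) * ∑' q, ‖mFourierCoeff X₂ (g q)‖ ^ 2 := tsum_mul_left
      _ ≤ (1 / (N : ℝ) ^ 2) * ∫ x, ‖X₂ x‖ ^ 2 := by
          refine mul_le_mul_of_nonneg_left ?_ (by positivity)
          rw [← hP2.tsum_eq]
          exact tsum_comp_le_tsum_of_inj hP2.summable (fun n => sq_nonneg _) hinj
      _ = (∫ x, ‖X₂ x‖ ^ 2) / (N : ℝ) ^ 2 := by ring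
  obtain ⟨hcs, hcarl⟩ := tsum_norm_le_sqrt_mul_add hc2.1 hD2.1 hDq hQ
  -- the moment sequence on the lattice
  set f : (d → ℤ) → ℝ := fun n => ω n * ‖mFourierCoeff X n‖ with hf_def
  have hf_axis : ∀ q : ℤ, f (g q) ≤ L / (2 * Real.pi) * (if q = 0 then 0 else ‖c q‖) := by
    intro q
    simp only [hf_def]
    by_cases hq : q = 0
    · rw [hq, if_pos rfl, mul_zero]
      have : ω (g 0) ≤ 0 := by
        have h := hω (g 0)
        rw [hgj] at h
        simpa using h
      have h0 : ω (g 0) = 0 := le_antisymm this (hω0 _)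
      rw [h0, zero_mul]
    · rw [if_neg hq]
      have hNq : ((N : ℤ) * q : ℝ) ≠ 0 := by
        have : ((N : ℤ) * q) ≠ 0 := mul_ne_zero hNz hq
        exact_mod_cast this
      have hX : ‖mFourierCoeff X (g q)‖ = ‖c q‖ / (2 * Real.pi * |((N : ℤ) * q : ℝ)|) := by
        have e := h1 (g q)
        rw [hgj] at e
        rw [hc_def]; simp only []
        rw [e, norm_mul]
        have en : ‖(2 * Real.pi * Complex.I * (((N : ℤ) * q : ℤ) : ℂ) : ℂ)‖ = 2 * Real.pi * |((N : ℤ) * q : ℝ)| := by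
          have e1 : (2 * Real.pi * Complex.I * (((N : ℤ) * q : ℤ) : ℂ) : ℂ) =
              ((2 * Real.pi * (((N : ℤ) * q : ℤ) : ℝ) : ℝ) : ℂ) * Complex.I := by
            push_cast; try ring
          rw [e1, norm_mul, Complex.norm_I, mul_one, Complex.norm_real, Real.norm_eq_abs, abs_mul,
            abs_of_pos (by positivity : (0 : ℝ) < 2 * Real.pi)]
          push_cast; ring_nf
        rw [en]
        have : (2 * Real.pi * |((N : ℤ) * q : ℝ)|) ≠ 0 := by positivity
        field_simp
      rw [hX]
      have hωq : ω (g q) ≤ L * |((N : ℤ) * q : ℝ)| := by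
        have h := hω (g q); rw [hgj] at h; exact_mod_cast h
      calc ω (g q) * (‖c q‖ / (2 * Real.pi * |((N : ℤ) * q : ℝ)|))
          ≤ (L * |((N : ℤ) * q : ℝ)|) * (‖c q‖ / (2 * Real.pi * |((N : ℤ) * q : ℝ)|)) :=
            mul_le_mul_of_nonneg_right hωq (by positivity)
        _ = L / (2 * Real.pi) * ‖c q‖ := by field_simp
  have hf_off : ∀ n : d → ℤ, n ∉ Set.range g → f n = 0 := by
    intro n hn
    simp only [hf_def]
    by_cases hz : mFourierCoeff X n = 0
    · rw [hz, norm_zero, mul_zero]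
    · exfalso; apply hn
      obtain ⟨hax, q, hq⟩ := hsupp n hz
      refine ⟨q, ?_⟩
      show (Pi.single j ((N : ℤ) * q) : d → ℤ) = n
      funext l
      by_cases hl : l = j
      · subst hl; simp [hq]
      · rw [Pi.single_eq_of_ne hl, hax l hl]
  have hg' : Summable fun q : ℤ => L / (2 * Real.pi) * (if q = 0 then 0 else ‖c q‖) := by
    refine Summable.mul_left _ ?_
    exact (hcs.of_nonneg_of_le (fun q => by split_ifs <;> positivity) fun q => by split_ifs <;> simp)
  have hf_nn : ∀ n, 0 ≤ f n := fun n => mul_nonneg (hω0 n) (norm_nonneg _)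
  have hf_comp : Summable (f ∘ g) := hg'.of_nonneg_of_le (fun q => hf_nn _) hf_axis
  have hfs : Summable f := (Function.Injective.summable_iff hinj hf_off).mp hf_comp
  refine ⟨hfs, ?_⟩
  have heq : ∑' n, f n = ∑' q : ℤ, f (g q) :=
    (Function.Injective.tsum_eq hinj (f := f) (fun n hn => by
      by_contra h; exact hn (hf_off n h))).symm
  rw [heq]
  have hsqD : Real.sqrt (∑' q, ‖D q‖ ^ 2) ≤ Real.sqrt (∫ x, ‖X₂ x‖ ^ 2) / N := by
    calc Real.sqrt (∑' q, ‖D q‖ ^ 2) ≤ Real.sqrt ((∫ x, ‖X₂ x‖ ^ 2) / (N : ℝ) ^ 2) := Real.sqrt_le_sqrt hD2.2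
      _ = Real.sqrt (∫ x, ‖X₂ x‖ ^ 2) / N := by
          rw [Real.sqrt_div' _ (sq_nonneg _), Real.sqrt_sq hNpos.le]
  calc ∑' q : ℤ, f (g q) ≤ ∑' q : ℤ, L / (2 * Real.pi) * (if q = 0 then 0 else ‖c q‖) :=
        hf_comp.tsum_le_tsum hf_axis hg'
    _ = L / (2 * Real.pi) * ∑' q : ℤ, (if q = 0 then 0 else ‖c q‖) := tsum_mul_left
    _ ≤ L / (2 * Real.pi) * (Real.sqrt (2 * Q) * Real.sqrt (∑' q, ‖c q‖ ^ 2) +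
          Real.sqrt (∑' q, ‖D q‖ ^ 2) / (Real.pi * Real.sqrt (2 * Q))) :=
        mul_le_mul_of_nonneg_left hcarl (by positivity)
    _ ≤ L / (2 * Real.pi) * (Real.sqrt (2 * Q) * Real.sqrt (∫ x, ‖X₁ x‖ ^ 2) +
          Real.sqrt (∫ x, ‖X₂ x‖ ^ 2) / ((N : ℝ) * (Real.pi * Real.sqrt (2 * Q)))) := by
        refine mul_le_mul_of_nonneg_left (add_le_add ?_ ?_) (by positivity)
        · exact mul_le_mul_of_nonneg_left (Real.sqrt_le_sqrt hc2.2) (Real.sqrt_nonneg _)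
        · calc Real.sqrt (∑' q, ‖D q‖ ^ 2) / (Real.pi * Real.sqrt (2 * Q))
              ≤ (Real.sqrt (∫ x, ‖X₂ x‖ ^ 2) / N) / (Real.pi * Real.sqrt (2 * Q)) :=
                div_le_div_of_nonneg_right hsqD (by positivity)
            _ = Real.sqrt (∫ x, ‖X₂ x‖ ^ 2) / ((N : ℝ) * (Real.pi * Real.sqrt (2 * Q))) := by rw [div_div]

end Summit.AnomalousDissipation.AnomalousDissipation.Theorems.SawtoothPulseCascade.K1Slot
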